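import Mathlib.Analysis.SpecialFunctions.Exponential
import Mathlib.Topology.UniformSpace.UniformConvergence
import Literature.Analysis.FluidPDE.HardSpherePhaseSpace
import Literature.Analysis.FluidPDE.HardSphereDynamics
import Literature.Analysis.FluidPDE.BBGKYMarginals
import HarnessLib

-- provenance: harness21/H21/H21/Statements/Hilbert6/HardSphereBBGKY.lean @ 70808d2 (interim HEAD d8f2665); M5 mechanical rewrite
/-!
# Hard spheres on the torus: the model, Alexander's flow, Gibbs-type data and the BBGKY hierarchy

Family `hilbert6` (trunk FluidKinetic / T-KINETIC, item H6HardSphereBBGKY), statements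
**hilbert6.S04**, **hilbert6.S05**, **hilbert6.S06**, **hilbert6.S07**. The position space is
the flat torus `T^d = UnitAddTorus d` with the minimal-image geometry `Torus.geometry d`
(twins on `ℝ^d = EuclideanSpace ℝ d` with `Euclidean.geometry d` where the literature states
them there); the phase space, dynamics and hierarchies are the accepted preludes
`Literature.Prelude.FluidKinetic.HardSpherePhaseSpace` (K1), `…HardSphereDynamics` (K2),
`…BBGKYMarginals` (K3). This file only *restates* their content with the inventory ids.

* **hilbert6.S04** (definition-role; CIP 1994 §4.2, GST 2013 Ch. 1): the hard-sphere model —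
  `hardSphereModel_spec` (free flight preserves Lebesgue measure on `(T^d × ℝ^d)^N`, binary
  elastic collisions conserve kinetic energy and momentum and are involutions, the Liouville
  measure is Lebesgue measure restricted to `D_ε^N`) and
  `measurePreserving_hardSphereFlow_liouville` (the hard-sphere flow preserves the Liouville
  measure).
* **hilbert6.S05** (Alexander 1975; GST 2013 Prop. 4.1.1; CIP 1994 App. 4.A): existence and
  Liouville-a.e. uniqueness of the hard-sphere flow,
  `alexander_hardSphereFlow_exists_unique_ae` (torus, `0 < ε < 1/2`) and
  `alexander_hardSphereFlow_exists_unique_ae_euclidean` (`ℝ^d`, `0 < ε`). "No triple / grazing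
  collisions, finitely many collisions in finite time, measure preserving" are the fields of
  the hypothesis structure `Kinetic.HardSphereFlow`.
* **hilbert6.S06** (GST 2013 (6.1.2)–(6.1.5), Prop. 6.1.1–6.1.2; BGSS 2023 §1.1): the
  *canonical* Gibbs-type density `Kinetic.canonicalDensity` is a probability density
  (`integral_canonicalDensity`) and the grand-canonical data `Kinetic.gcInitial` are its
  Poissonisation, `W_N = 𝒵⁻¹ μ^N 𝒵_N f_{N,0}` (`gcInitial_eq_canonicalDensity`), forming a
  probability (`gcInitial_normalised`, with the *single* `1/N!` in the measure — K3's
  convention); the correlation functions without exclusion are exactly `f₀^{⊗s}`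
  (`correlationFn_gcInitial_zero_exclusion`), satisfy the uniform Gaussian bound of GST
  Prop. 6.1.1 (`correlationFn_gcInitial_bound`) and are asymptotically factorised in the
  Boltzmann–Grad scaling `μ_ε ε^{d-1} = 1` (`gcInitial_chaotic_pointwise`, the torus case of the
  prelude's pointwise `Kinetic.correlationFn_gcInitial_tendsto_tensorPow`, and, for bounded
  `f₀`, its locally uniform strengthening `gcInitial_chaotic`; BGSS 2023 §1.1, the
  grand-canonical form — GST Prop. 6.1.2 is the canonical analogue).
* **hilbert6.S07** (CIP 1994 §4.3–4.4; GST 2013 §4.3–4.4, (4.3.7)–(4.3.9), (4.4.2)–(4.4.7)):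
  the marginals of a transported symmetric density continuous on `D_ε^N` solve the mild BBGKY
  hierarchy (`bbgky_hierarchy_of_liouville`, the prelude's `Kinetic.liouville_imp_bbgky`), a
  mild BBGKY solution equals the finite sum of its
  iterated Duhamel (collision-tree) terms (`bbgky_duhamel_expansion`), and a mild solution of
  the *Boltzmann hierarchy* — free transport and the collision operator `Kinetic.boltzmannHOp`,
  the formal `ε → 0` limit of `Kinetic.bbgkyOp` with `x_{s+1} = x_i` — in the Lanford class is
  the sum of its Duhamel series for short times (`boltzmann_hierarchy_duhamel_series`). The
  re-parametrisation of the Duhamel integrals by pseudo-trajectories (GST 2013 Ch. 5) is only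
  cited.

## Sources

* C. Cercignani, R. Illner, M. Pulvirenti, *The Mathematical Theory of Dilute Gases* (1994),
  §4.2–4.3, App. 4.A.
* I. Gallagher, L. Saint-Raymond, B. Texier, *From Newton to Boltzmann: hard spheres and
  short-range potentials* (2013), Ch. 1, Prop. 4.1.1, §4.3–4.4, Ch. 5, (6.1.2)–(6.1.5),
  Prop. 6.1.1, Prop. 6.1.2 (equation numbers of §4.3–4.4 as in K3; the proposition number
  of the mild BBGKY statement in §4.3 is not cited, being unverified).
* O. E. Lanford III, *Time evolution of large classical systems*, Lecture Notes in Physics 38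
  (1975).
* R. K. Alexander, *The infinite hard sphere system*, PhD thesis, Berkeley (1975).
* T. Bodineau, I. Gallagher, L. Saint-Raymond, S. Simonella, *Long-time correlations for a
  hard-sphere gas at equilibrium* / *Statistical dynamics of a hard sphere gas*, §1.1
  (1.1.3)–(1.1.6) (2023).

## Mathlib / H21 reuse

Mathlib has no hard-sphere / billiard dynamics, BBGKY hierarchy or Gibbs point process (searched
`hard.?sphere`, `billiard`, `BBGKY`, `grand.?canonical`: nothing). Reused from Mathlib:
`MeasureTheory.MeasurePreserving`, `Measure.restrict`, `Filter.EventuallyEq` (`=ᵐ`),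
`TendstoUniformlyOn`, `IsCompact`, `tsum`, `Nat.factorial`, `UnitAddTorus`. Everything kinetic
is the preludes': `Kinetic.freeFlight`, `Kinetic.collidePair`, `Kinetic.liouville`,
`Kinetic.HardSphereFlow` (+ `.nonempty`, `.nonempty_torus`, `.flow_eq_ae`), `Kinetic.gcInitial`,
`Kinetic.gcPartition`, `Kinetic.canonicalDensity`, `Kinetic.canonicalPartition`,
`Kinetic.correlationFn`, `Kinetic.tensorPow`, `Kinetic.nthMarginal`, `Kinetic.hsTransport`,
`Kinetic.IsMildBBGKYSolutionOn`, `Kinetic.bbgkyDuhamelTerm`, `Kinetic.liouville_imp_bbgky`,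
`Kinetic.IsMildBBGKYSolutionOn.eq_sum_bbgkyDuhamelTerm`,
`Kinetic.IsMildBoltzmannHierarchySolutionOn` (+ `.exists_hasSum_boltzmannDuhamelTerm`),
`Kinetic.boltzmannDuhamelTerm`, `Kinetic.correlationFn_gcInitial_tendsto_tensorPow`.

## Design choices

* Namespace `Literature.Hilbert6` (statement layer). Proofs are the prelude lemmas whenever these
  exist (fields of `HardSphereFlow`, `liouville_imp_bbgky`, …); the one remaining `sorry`
  (`gcInitial_chaotic`) is a known theorem in print.
* Three small prelude-level helper lemmas (with real proofs) are placed in the declaring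
  namespaces (`Kinetic.hardSphereDomain_zero`, `Torus.measurable_geometry_translate`,
  `Torus.volume_setOf_norm_sepVec_lt_le`); they are back-port candidates for K1
  (`HardSpherePhaseSpace`) and carry no id.
* `alexander_hardSphereFlow_exists_unique_ae` on `T^d` carries `ε < 1/2`, as the prelude's
  `HardSphereFlow.nonempty_torus`: for larger diameters the contact condition on the unit torus
  is not the minimal-image one.
* `gcInitial_normalised`, `integral_canonicalDensity`, `gcInitial_eq_canonicalDensity`,
  `correlationFn_gcInitial_zero_exclusion` and `correlationFn_gcInitial_bound` are stated for
  an arbitrary geometry (they cost nothing more). The chaos statements are on `T^d` with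
  `2 ≤ card d` in the prelude's Lanford class `f₀(x, v) ≤ g(v)`, `g` integrable:
  `gcInitial_chaotic_pointwise` is the prelude lemma plus the torus ball-volume bound
  `Torus.volume_setOf_norm_sepVec_lt_le`; `gcInitial_chaotic` (same hypotheses plus `f₀` bounded,
  which is needed: uniform convergence of the *difference* `F^{(s)}_ε - f₀^{⊗s}` on a compact
  `K` requires a bound on `f₀^{⊗s}` over `K`, whereas the ratio converges uniformly for free)
  is its locally uniform strengthening, "locally uniformly off the diagonal" being
  `TendstoUniformlyOn` on every compact set of configurations with pairwise distinct positions
  (written inline; Mathlib's `Set.offDiag` is the binary notion), which keeps this file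
  independent of the Boltzmann–Grad limit prelude.
* `correlationFn_gcInitial_zero_exclusion` is the `ε = 0` sanity check documenting K3's
  factorial convention: `hardSphereDomain G N 0 = univ` (`Kinetic.hardSphereDomain_zero`), so
  the indicator drops and `F^{(s)} = f₀^{⊗s}` exactly.
* `boltzmann_hierarchy_duhamel_series` is on `T^d`; the measurability of the torus translation
  `(x, v) ↦ x + proj v` needed by `eq_sum_bbgkyDuhamelTerm` is
  `Torus.measurable_geometry_translate`.
* `bbgky_hierarchy_of_liouville` asserts, as the prelude does, the existence of *versions* of
  the a.e.-defined marginals `nthMarginal N s (1_{good} T^ε_N(t) W)` solving the hierarchy at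
  every good `Z_s` (`Kinetic.IsMildBBGKYSolutionOnGood`; the collision operator is a trace on
  a null set, GST 2013 Ch. 5, and the prelude flow is junk off its good set), whereas
  `bbgky_duhamel_expansion` consumes the *everywhere* notion `Kinetic.IsMildBBGKYSolutionOn`
  (plus the two flow normalisations `hΦE`, `hΦm` of the prelude lemma); the two S07 statements
  therefore do not compose directly — this mirrors the prelude (K3, docstrings of
  `IsMildBBGKYSolutionOn` and `eq_sum_bbgkyDuhamelTerm`). Since the conclusion pins `F s t`
  only a.e. and the identity only on `(Φ s).good`, the boundary values of `F (s+1)` fed to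
  `bbgkyOp` are part of the existential choice ("the marginals solve the hierarchy for *some*
  trace"); pinning the trace by regularity of the marginals along the flow (GST Ch. 5,
  Simonella 2014) is not stated.
* Continuity hypothesis of **hilbert6.S07**: only `ContinuousOn W D_ε^N` is assumed, as in
  print (CIP 1994 §4.3, GST 2013 §4.3) and in the prelude, so that the Gibbs-type data
  `𝒵_N⁻¹ 1_{D_ε^N} f₀^{⊗N}` of **hilbert6.S06** (discontinuous across `∂D_ε^N` as functions on
  `(T^d × ℝ^d)^N`), i.e. exactly the data of Lanford's theorem, are covered. The restriction
  `ε ≤ 1/2` is the prelude's (round minimal-image contact sphere on the unit torus).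
* Only the grand-canonical chaos statements (BGSS 2023 §1.1) are stated; the canonical
  analogue (GST 2013 Prop. 6.1.2, `N ε^{d-1} = 1`, marginals of `Kinetic.canonicalDensity`) is
  not, S06 being definition-role.
-/

open MeasureTheory Metric Real Set Filter Topology
open scoped InnerProductSpace ENNReal Nat

namespace Literature.MathematicalPhysics.KineticTheory

noncomputable section

variable {d : Type*} [Fintype d]

/-! ## Prelude-level helper lemmas (back-port candidates for K1) -/

section Helpers

/-- Without exclusion (`ε = 0`) the hard-sphere domain is the whole phase space
(`‖·‖ ≥ 0`). Back-port candidate for `Literature.Prelude.FluidKinetic.HardSpherePhaseSpace` (where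
it should become a `simp` lemma). [folklore] -/
theorem hardSphereDomain_zero {X : Type*} (G : Literature.Analysis.FluidPDE.Geometry d X) (N : ℕ) :
    Literature.Analysis.FluidPDE.hardSphereDomain G N 0 = univ :=
  eq_univ_of_forall fun _ _ _ _ => norm_nonneg _

/-- The torus translation `(x, v) ↦ x + proj v` is (jointly) measurable (`proj` is continuous,
`Torus.continuous_proj`). Back-port candidate for
`Literature.Prelude.FluidKinetic.HardSpherePhaseSpace`. [folklore] -/
theorem Torus.measurable_geometry_translate :
    Measurable fun p : UnitAddTorus d × EuclideanSpace ℝ d =>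
      (Literature.Analysis.FluidPDE.Torus.geometry d).translate p.1 p.2 :=
  (continuous_fst.add (Literature.Analysis.FunctionSpaces.Torus.continuous_proj.comp continuous_snd)).measurable

/-- Sublevel sets of the minimal-image distance on `T^d` ("balls", though not a Mathlib
`Metric.ball`: the metric on `UnitAddTorus d` is the sup metric) have Haar volume `O(r^d)`:
`vol {y | ‖reprSym (y - x)‖ < r} ≤ 2^d r^d`, since `|reprSym z i| = ‖z i‖ ≤ ‖reprSym z‖`
coordinatewise and an arc of `UnitAddCircle` of half-width `r` has measure `min (2r) 1`
(`AddCircle.volume_closedBall`, `volume_pi_closedBall`: the set lies in the sup-metric ball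
of radius `r`). This is the hypothesis `hvol` of
`Kinetic.correlationFn_gcInitial_tendsto_tensorPow` for `Torus.geometry d`. Back-port
candidate for `Literature.Prelude.FluidKinetic.HardSpherePhaseSpace`. [folklore] -/
theorem Torus.volume_setOf_norm_sepVec_lt_le (x : UnitAddTorus d) {r : ℝ} (hr : 0 < r) :
    volume {y : UnitAddTorus d | ‖(Literature.Analysis.FluidPDE.Torus.geometry d).sepVec y x‖ < r} ≤
      (2 : ℝ≥0∞) ^ Fintype.card d * ENNReal.ofReal (r ^ Fintype.card d) := by
  have hsub : {y : UnitAddTorus d | ‖(Literature.Analysis.FluidPDE.Torus.geometry d).sepVec y x‖ < r} ⊆ closedBall x r := by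
    intro y hy
    rw [mem_setOf_eq, Literature.Analysis.FluidPDE.Torus.geometry_sepVec] at hy
    rw [mem_closedBall, dist_pi_le_iff hr.le]
    intro i
    rw [dist_eq_norm, ← Pi.sub_apply, ← Literature.Analysis.FluidPDE.Torus.abs_reprSym_apply, ← Real.norm_eq_abs]
    exact (PiLp.norm_apply_le _ i).trans hy.le
  calc volume {y : UnitAddTorus d | ‖(Literature.Analysis.FluidPDE.Torus.geometry d).sepVec y x‖ < r}
      ≤ volume (closedBall x r) := measure_mono hsub
    _ = ∏ i, volume (closedBall (x i) r) := volume_pi_closedBall x hr.le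
    _ ≤ ∏ _i : d, ENNReal.ofReal (2 * r) := by
        refine Finset.prod_le_prod' fun i _ => ?_
        rw [AddCircle.volume_closedBall]
        exact ENNReal.ofReal_le_ofReal (min_le_right _ _)
    _ = 2 ^ Fintype.card d * ENNReal.ofReal (r ^ Fintype.card d) := by
        rw [Finset.prod_const, Finset.card_univ, ENNReal.ofReal_mul zero_le_two,
          ENNReal.ofReal_ofNat, mul_pow, ENNReal.ofReal_pow hr.le]

end Helpers

section Hilbert6

/-! ## hilbert6.S04: the hard-sphere model on `T^d` -/

section Model

/-- **hilbert6.S04** (the hard-sphere model on `T^d`; CIP 1994 §4.2, GST 2013 Ch. 1,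
(1.1.1)–(1.1.3)). For `N` hard spheres of diameter `ε` on the flat torus with the
minimal-image geometry: (i) free flight `(x_i, v_i) ↦ (x_i + t v_i, v_i)` preserves Lebesgue
measure on `(T^d × ℝ^d)^N`; (ii) the binary elastic collision of any pair `i ≠ j` conserves
the kinetic energy `½ ∑ |v_i|²` and the momentum `∑ v_i` and is an involution; (iii) the
Liouville measure is Lebesgue measure restricted to the phase space
`D_ε^N = {∀ i ≠ j, ε ≤ |x_i - x_j|}`. Part (ii) is stated at *every* configuration `z`, not
only at contact `|x_i - x_j| = ε` with incoming velocities where the dynamics applies it (the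
algebraic identities hold regardless). The name bundles the id-carrying restatement of the
model (statement layer only). Proof: the prelude lemmas `measurePreserving_freeFlight_torus`,
`configEnergy_collidePair`, `configMomentum_collidePair`, `collidePair_collidePair`,
`liouville_eq`. [cite: CIP1994, §4.2  GST 2013 Ch. 1  (1.1.1] -/
def hardSphereModel_spec : Prop :=
  ∀ (N : ℕ) (ε : ℝ),
    (∀ t : ℝ, MeasurePreserving (Literature.Analysis.FluidPDE.freeFlight (N := N) (Literature.Analysis.FluidPDE.Torus.geometry d) t) volume volume) ∧
    (∀ (i j : Fin N), i ≠ j → ∀ z : Literature.Analysis.FluidPDE.Config N d (UnitAddTorus d),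
      Literature.Analysis.FluidPDE.configEnergy (Literature.Analysis.FluidPDE.collidePair (Literature.Analysis.FluidPDE.Torus.geometry d) i j z) =
          Literature.Analysis.FluidPDE.configEnergy z ∧
        Literature.Analysis.FluidPDE.configMomentum (Literature.Analysis.FluidPDE.collidePair (Literature.Analysis.FluidPDE.Torus.geometry d) i j z) =
          Literature.Analysis.FluidPDE.configMomentum z ∧
        Literature.Analysis.FluidPDE.collidePair (Literature.Analysis.FluidPDE.Torus.geometry d) i j
          (Literature.Analysis.FluidPDE.collidePair (Literature.Analysis.FluidPDE.Torus.geometry d) i j z) = z) ∧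
    Literature.Analysis.FluidPDE.liouville (Literature.Analysis.FluidPDE.Torus.geometry d) N ε =
      volume.restrict (Literature.Analysis.FluidPDE.hardSphereDomain (Literature.Analysis.FluidPDE.Torus.geometry d) N ε)

/- interim proof relied on results that are now named facts (D-0014); demoted to a fact by the M5 import, proof preserved:
:=
  ⟨fun t => Kinetic.measurePreserving_freeFlight_torus t,
    fun _ _ hij z => ⟨Kinetic.configEnergy_collidePair hij z,
      Kinetic.configMomentum_collidePair hij z, Kinetic.collidePair_collidePair hij z⟩,
    Kinetic.liouville_eq _ _ _⟩
-/

/-- **hilbert6.S04** (invariance of the Liouville measure; CIP 1994 §4.2, GST 2013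
Prop. 4.1.1). Every hard-sphere flow of `N` spheres of diameter `ε` on `T^d` preserves the
Liouville measure at every time (a field of the hypothesis structure `Kinetic.HardSphereFlow`).
[cite: CIP1994, §4.2  GST 2013 Prop. 4.1.1] -/
theorem measurePreserving_hardSphereFlow_liouville {ε : ℝ} {N : ℕ}
    (Φ : Literature.Analysis.FluidPDE.HardSphereFlow (Literature.Analysis.FluidPDE.Torus.geometry d) ε N) (t : ℝ) :
    MeasurePreserving (Φ.flow t) (Literature.Analysis.FluidPDE.liouville (Literature.Analysis.FluidPDE.Torus.geometry d) N ε)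
      (Literature.Analysis.FluidPDE.liouville (Literature.Analysis.FluidPDE.Torus.geometry d) N ε) :=
  Φ.measurePreserving t

end Model

/-! ## hilbert6.S05: Alexander's theorem -/

section Alexander

/-- **hilbert6.S05** (Alexander's theorem on `T^d`; Alexander 1975; GST 2013 Prop. 4.1.1;
CIP 1994 App. 4.A). For `0 < ε < 1/2` and every `N`, the hard-sphere flow of `N` spheres of
diameter `ε` on the flat torus exists — outside a Liouville-null set of initial data there are
no multiple or grazing collisions and finitely many collisions in finite time, the dynamics is
globally defined, measurable and preserves the Liouville measure (all encoded in
`Kinetic.HardSphereFlow`) — and it is unique: two such flows agree Liouville-a.e. at every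
time. Named fact: in the interim library this was the conjunction of the prelude's sorried
`Kinetic.HardSphereFlow.nonempty_torus` and `Kinetic.HardSphereFlow.flow_eq_ae`. [cite: Alexander1975] -/
def alexander_hardSphereFlow_exists_unique_ae : Prop :=
  ∀ {ε : ℝ} (_hε : 0 < ε) (_hε' : ε < 2⁻¹) (N : ℕ),
    Nonempty (Literature.Analysis.FluidPDE.HardSphereFlow (Literature.Analysis.FluidPDE.Torus.geometry d) ε N) ∧
      ∀ (Φ Ψ : Literature.Analysis.FluidPDE.HardSphereFlow (Literature.Analysis.FluidPDE.Torus.geometry d) ε N) (t : ℝ),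
        Φ.flow t =ᵐ[Literature.Analysis.FluidPDE.liouville (Literature.Analysis.FluidPDE.Torus.geometry d) N ε] Ψ.flow t

/-- **hilbert6.S05** (Alexander's theorem in `ℝ^d`; Alexander 1975; GST 2013 Prop. 4.1.1;
CIP 1994 App. 4.A). For every `ε > 0` and `N`, the hard-sphere flow of `N` spheres of diameter
`ε` in `ℝ^d` exists and is unique Liouville-a.e. Named fact: in the interim library this was the
conjunction of the prelude's sorried `Kinetic.HardSphereFlow.nonempty` and
`Kinetic.HardSphereFlow.flow_eq_ae`. [cite: Alexander1975] -/
def alexander_hardSphereFlow_exists_unique_ae_euclidean : Prop :=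
  ∀ {ε : ℝ} (_hε : 0 < ε) (N : ℕ),
    Nonempty (Literature.Analysis.FluidPDE.HardSphereFlow (Literature.Analysis.FluidPDE.Euclidean.geometry d) ε N) ∧
      ∀ (Φ Ψ : Literature.Analysis.FluidPDE.HardSphereFlow (Literature.Analysis.FluidPDE.Euclidean.geometry d) ε N) (t : ℝ),
        Φ.flow t =ᵐ[Literature.Analysis.FluidPDE.liouville (Literature.Analysis.FluidPDE.Euclidean.geometry d) N ε] Ψ.flow t

end Alexander

/-! ## hilbert6.S06: grand-canonical Gibbs-type data and their correlation functions -/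

section GrandCanonical

variable {X : Type*} [MeasureSpace X]

/-- **hilbert6.S06** (normalisation of the grand-canonical Gibbs-type data; GST 2013 (6.1.4);
BGSS 2023 (1.1.5)). With K3's convention — the `1/N!` of indistinguishability sits in the
measure `∑_N (N!)⁻¹ W_N dZ_N`, not in `W_N = gcInitial G ε μ f₀ N = 𝒵⁻¹ μ^N 1_{D_ε^N} f₀^{⊗N}` —
the grand-canonical state is a probability: `∑_N (N!)⁻¹ ∫ W_N dZ_N = 1`, for a nonnegative
integrable reference density `f₀` and activity `μ ≥ 0` (so that `0 < 𝒵^ε < ∞`,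
`Kinetic.gcPartition_pos`, which uses Fubini on `(X × ℝ^d)^N`, whence σ-finiteness). [cite: GST2013, (6.1.4] -/
def gcInitial_normalised : Prop :=
  ∀ [SigmaFinite (volume : Measure X)] (G : Literature.Analysis.FluidPDE.Geometry d X) (ε : ℝ) {μ : ℝ} (hμ : 0 ≤ μ) {f₀ : X × EuclideanSpace ℝ d → ℝ} (hf₀ : 0 ≤ f₀) (hf₀' : Integrable f₀),
    ∑' N : ℕ, (N ! : ℝ)⁻¹ * ∫ z, Literature.Analysis.FluidPDE.gcInitial G ε μ f₀ N z = 1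

/- interim proof relied on results that are now named facts (D-0014); demoted to a fact by the M5 import, proof preserved:
:= by
  have hZ := Kinetic.gcPartition_pos G ε hμ hf₀ hf₀'
  have h : ∀ N : ℕ, (N ! : ℝ)⁻¹ * ∫ z, Kinetic.gcInitial G ε μ f₀ N z =
      (Kinetic.gcPartition G ε μ f₀)⁻¹ *
        (μ ^ N / (N ! : ℝ) * Kinetic.canonicalPartition G ε N f₀) := by
    intro N
    simp only [Kinetic.gcInitial, Kinetic.canonicalPartition, integral_const_mul]
    ring
  simp_rw [h, tsum_mul_left]
  exact inv_mul_cancel₀ hZ.ne'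
-/

/-- **hilbert6.S06** (the canonical Gibbs-type initial measure; GST 2013 (6.1.2)–(6.1.3)).
The canonical `N`-particle density `f_{N,0} = 𝒵_N⁻¹ 1_{D_ε^N} f₀^{⊗N}`
(`Kinetic.canonicalDensity`) is a probability density whenever its partition function
`𝒵_N = ∫ 1_{D_ε^N} f₀^{⊗N}` is nonzero (e.g. `0 ≤ f₀` and `D_ε^N ∩ {f₀^{⊗N} > 0}` non-null;
for `𝒵_N = 0` the prelude's junk value is `f_{N,0} = 0`). [cite: GST2013, (6.1.2] -/
theorem integral_canonicalDensity (G : Literature.Analysis.FluidPDE.Geometry d X) (ε : ℝ) (N : ℕ)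
    (f₀ : X × EuclideanSpace ℝ d → ℝ) (hZ : Literature.Analysis.FluidPDE.canonicalPartition G ε N f₀ ≠ 0) :
    ∫ z, Literature.Analysis.FluidPDE.canonicalDensity G ε N f₀ z = 1 := by
  simp only [Literature.Analysis.FluidPDE.canonicalDensity, integral_const_mul]
  exact inv_mul_cancel₀ hZ

/-- **hilbert6.S06** (grand-canonical = Poissonised canonical data; GST 2013 (6.1.4); BGSS 2023
(1.1.5)). The grand-canonical Gibbs-type state is the mixture of the canonical ones:
`W_N = (𝒵^ε)⁻¹ μ^N 𝒵_N f_{N,0}` for every `N` with `𝒵_N ≠ 0`, so that with the measure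
`∑_N (N!)⁻¹ W_N dZ_N` the particle number is distributed as `(𝒵^ε)⁻¹ μ^N 𝒵_N / N!`. [cite: GST2013, (6.1.4] -/
theorem gcInitial_eq_canonicalDensity (G : Literature.Analysis.FluidPDE.Geometry d X) (ε μ : ℝ) {N : ℕ}
    (f₀ : X × EuclideanSpace ℝ d → ℝ) (hZ : Literature.Analysis.FluidPDE.canonicalPartition G ε N f₀ ≠ 0) :
    Literature.Analysis.FluidPDE.gcInitial G ε μ f₀ N = fun z =>
      (Literature.Analysis.FluidPDE.gcPartition G ε μ f₀)⁻¹ * μ ^ N * Literature.Analysis.FluidPDE.canonicalPartition G ε N f₀ *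
        Literature.Analysis.FluidPDE.canonicalDensity G ε N f₀ z := by
  funext z
  simp only [Literature.Analysis.FluidPDE.gcInitial, Literature.Analysis.FluidPDE.canonicalDensity]
  field_simp

/-- **hilbert6.S06** (sanity check of the factorial convention, K3 module docstring; GST 2013
(6.1.5); BGSS 2023 (1.1.6)). Without exclusion (`ε = 0`, so `1_{D_0^N} = 1` by
`Kinetic.hardSphereDomain_zero`) the grand-canonical state is a Poisson point process:
`𝒵 = exp (μ ∫ f₀)` and the rescaled correlation functions are *exactly* factorised,
`F^{(s)}(Z_s) = μ^{-s} 𝒵⁻¹ ∑_p (p!)⁻¹ μ^{s+p} f₀^{⊗s}(Z_s) (∫ f₀)^p = f₀^{⊗s}(Z_s)`, for any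
geometry, any activity `μ ≠ 0` and any `f₀` (Fubini on `(X × ℝ^d)^p`,
`MeasureTheory.integral_fintype_prod_volume_eq_pow`, whence σ-finiteness; no integrability is
needed, the Bochner junk value `∫ f₀ = 0` being consistent throughout). [cite: GST2013, (6.1.5] -/
theorem correlationFn_gcInitial_zero_exclusion [SigmaFinite (volume : Measure X)]
    (G : Literature.Analysis.FluidPDE.Geometry d X) {μ : ℝ} (hμ : μ ≠ 0) (f₀ : X × EuclideanSpace ℝ d → ℝ) (s : ℕ) :
    Literature.Analysis.FluidPDE.correlationFn μ (Literature.Analysis.FluidPDE.gcInitial G 0 μ f₀) s = Literature.Analysis.FluidPDE.tensorPow s f₀ := by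
  funext Zs
  set I : ℝ := ∫ z, f₀ z
  have hexp : ∑' p : ℕ, (μ * I) ^ p / (p ! : ℝ) = Real.exp (μ * I) := by
    rw [Real.exp_eq_exp_ℝ, NormedSpace.exp_eq_tsum_div]
  have hpow : ∀ N, ∫ z : Literature.Analysis.FluidPDE.Config N d X, Literature.Analysis.FluidPDE.tensorPow N f₀ z = I ^ N := by
    intro N
    have h := integral_fintype_prod_volume_eq_pow (ι := Fin N) f₀
    rwa [Fintype.card_fin] at h
  have hZ : Literature.Analysis.FluidPDE.gcPartition G 0 μ f₀ = Real.exp (μ * I) := by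
    rw [← hexp]
    simp only [Literature.Analysis.FluidPDE.gcPartition, Literature.Analysis.FluidPDE.canonicalPartition, KineticTheory.hardSphereDomain_zero,
      indicator_univ, hpow, mul_pow]
    exact tsum_congr fun N => by ring
  have hmarg : ∀ p, Literature.Analysis.FluidPDE.marginal s p (Literature.Analysis.FluidPDE.gcInitial G 0 μ f₀ (s + p)) Zs =
      (Real.exp (μ * I))⁻¹ * μ ^ (s + p) * Literature.Analysis.FluidPDE.tensorPow s f₀ Zs * I ^ p := by
    intro p
    simp only [Literature.Analysis.FluidPDE.marginal, Literature.Analysis.FluidPDE.gcInitial, hZ, KineticTheory.hardSphereDomain_zero,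
      indicator_univ, Literature.Analysis.FluidPDE.tensorPow_append, ← mul_assoc, integral_const_mul, hpow]
  simp only [Literature.Analysis.FluidPDE.correlationFn, hmarg]
  have h : ∀ p, (p ! : ℝ)⁻¹ *
      ((Real.exp (μ * I))⁻¹ * μ ^ (s + p) * Literature.Analysis.FluidPDE.tensorPow s f₀ Zs * I ^ p) =
      μ ^ s * (Real.exp (μ * I))⁻¹ * Literature.Analysis.FluidPDE.tensorPow s f₀ Zs * ((μ * I) ^ p / (p ! : ℝ)) := by
    intro p; ring
  simp_rw [h, tsum_mul_left, hexp]
  field_simp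

/-- **hilbert6.S06** (uniform bound on the initial correlation functions; GST 2013
Prop. 6.1.1; BGSS 2023 §1.1). If `0 ≤ f₀(x, v) ≤ C₀ e^{-β|v|²/2}` (any real `β`; the Lanford
class is `0 < β`, but the sign plays no role in this bound) then the correlation functions of
the grand-canonical Gibbs-type state satisfy, for every `ε`, every activity `μ ≥ 0` and every
`s`, `0 ≤ F^{(s)}(Z_s) ≤ C₀^s e^{-β E(Z_s)}` with `E(Z_s) = ½ ∑ |v_i|²` — i.e.
`sup_s C₀^{-s} ‖F^{(s)} e^{β E}‖_∞ ≤ 1` uniformly in `ε`. From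
`Kinetic.correlationFn_gcInitial_le` (`F^{(s)} ≤ 1_{D_ε^s} f₀^{⊗s}`); the separation map of `G`
is assumed measurable (true for `Torus.geometry`, `Euclidean.geometry`) and `volume` on `X`
σ-finite (Fubini). [cite: GST2013, Prop. 6.1.1] -/
def correlationFn_gcInitial_bound : Prop :=
  ∀ [SigmaFinite (volume : Measure X)] {G : Literature.Analysis.FluidPDE.Geometry d X} (hG : Measurable fun p : X × X => G.sepVec p.1 p.2) (ε : ℝ) {μ : ℝ} (hμ : 0 ≤ μ) {f₀ : X × EuclideanSpace ℝ d → ℝ} (hf₀ : 0 ≤ f₀) (hf₀' : Integrable f₀) {C₀ β : ℝ} (hbound : ∀ x v, f₀ (x, v) ≤ C₀ * Real.exp (-(β / 2) * ‖v‖ ^ 2)) (s : ℕ) (Zs : Literature.Analysis.FluidPDE.Config s d X),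
    0 ≤ Literature.Analysis.FluidPDE.correlationFn μ (Literature.Analysis.FluidPDE.gcInitial G ε μ f₀) s Zs ∧
      Literature.Analysis.FluidPDE.correlationFn μ (Literature.Analysis.FluidPDE.gcInitial G ε μ f₀) s Zs ≤
        C₀ ^ s * Real.exp (-β * Literature.Analysis.FluidPDE.configEnergy Zs)

/- interim proof relied on results that are now named facts (D-0014); demoted to a fact by the M5 import, proof preserved:
:= by
  refine ⟨Kinetic.correlationFn_gcInitial_nonneg G ε hμ hf₀ hf₀' s Zs, ?_⟩
  refine (Kinetic.correlationFn_gcInitial_le hG ε hμ hf₀ hf₀' s Zs).trans ?_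
  refine (indicator_le_self' (fun z _ => Kinetic.tensorPow_nonneg hf₀ s z) Zs).trans ?_
  calc Kinetic.tensorPow s f₀ Zs = ∏ i, f₀ (Zs i) := rfl
    _ ≤ ∏ i : Fin s, C₀ * Real.exp (-(β / 2) * ‖(Zs i).2‖ ^ 2) :=
        Finset.prod_le_prod (fun i _ => hf₀ _) fun i _ => hbound (Zs i).1 (Zs i).2
    _ = C₀ ^ s * Real.exp (-β * Kinetic.configEnergy Zs) := by
        rw [Finset.prod_mul_distrib, Finset.prod_const, Finset.card_univ, Fintype.card_fin,
          ← Real.exp_sum]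
        congr 2
        simp only [Kinetic.configEnergy, Finset.mul_sum]
        exact Finset.sum_congr rfl fun i _ => by ring
-/

/-- **hilbert6.S06** (pointwise chaos of the grand-canonical Gibbs-type data on `T^d` in the
Boltzmann–Grad limit; BGSS 2023 §1.1; GST 2013 Prop. 6.1.2 (canonical analogue); Lanford
1975). Let `d ≥ 2` and
`f₀ ≥ 0` be an integrable one-particle density on `T^d × ℝ^d` dominated by an integrable
function of the velocity alone (`f₀(x, v) ≤ g(v)`, the prelude's Lanford class). In the scaling
`μ_ε = ε^{-(d-1)}` the rescaled correlation functions `F^{(s)}_{ε,0}` of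
`gcInitial (Torus.geometry d) ε μ_ε f₀` converge to `f₀^{⊗s}(Z_s)` as `ε → 0⁺` at every `Z_s`
with pairwise distinct positions. Proof: the torus case of the prelude's
`Kinetic.correlationFn_gcInitial_tendsto_tensorPow`, the symmetry of the minimal-image
distance being `Torus.euclidDist_comm` and the ball-volume hypothesis
`Torus.volume_setOf_norm_sepVec_lt_le`. [cite: BGSS2023, §1.1] -/
def gcInitial_chaotic_pointwise : Prop :=
  ∀ (hd : 2 ≤ Fintype.card d) {f₀ : UnitAddTorus d × EuclideanSpace ℝ d → ℝ} (hf₀ : 0 ≤ f₀) (hf₀' : Integrable f₀) {g : EuclideanSpace ℝ d → ℝ} (hg : Integrable g) (hfg : ∀ x v, f₀ (x, v) ≤ g v) (s : ℕ) {Zs : Literature.Analysis.FluidPDE.Config s d (UnitAddTorus d)} (hZs : ∀ i j, i ≠ j → (Zs i).1 ≠ (Zs j).1),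
    Tendsto
      (fun ε : ℝ => Literature.Analysis.FluidPDE.correlationFn (ε⁻¹ ^ (Fintype.card d - 1))
        (Literature.Analysis.FluidPDE.gcInitial (Literature.Analysis.FluidPDE.Torus.geometry d) ε (ε⁻¹ ^ (Fintype.card d - 1)) f₀) s Zs)
      (𝓝[>] 0) (𝓝 (Literature.Analysis.FluidPDE.tensorPow s f₀ Zs))

/- interim proof relied on results that are now named facts (D-0014); demoted to a fact by the M5 import, proof preserved:
:= by
  refine Kinetic.correlationFn_gcInitial_tendsto_tensorPow hd Torus.measurable_geometry_sepVec
    (fun x y => by rw [Torus.norm_geometry_sepVec, Torus.norm_geometry_sepVec,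
      Torus.euclidDist_comm])
    ⟨(2 : ℝ≥0∞) ^ Fintype.card d, by simp, fun x r hr => Torus.volume_setOf_norm_sepVec_lt_le x hr⟩
    hf₀ hf₀' hg hfg s fun i j hij h => hZs i j hij ?_
  have h' := congrArg Torus.proj h
  rwa [Torus.geometry_sepVec, Torus.proj_reprSym, Torus.proj_zero, sub_eq_zero] at h'
-/

/-- **hilbert6.S06** (locally uniform chaos of the grand-canonical Gibbs-type data on `T^d`;
BGSS 2023 §1.1; GST 2013 Prop. 6.1.2 is the canonical-ensemble analogue, `N ε^{d-1} = 1`;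
Lanford 1975). The locally uniform strengthening of `gcInitial_chaotic_pointwise` (and of the
prelude's pointwise `Kinetic.correlationFn_gcInitial_tendsto_tensorPow`), in the form printed
(for the canonical ensemble) in GST Prop. 6.1.2, with the hypotheses of the latter plus
boundedness of `f₀`: for `d ≥ 2` and a *bounded* integrable
`f₀ ≥ 0` in the Lanford class `f₀(x, v) ≤ g(v)`, `g` integrable (GST take
`g = C₀ e^{-β|v|²/2}`, which gives both), in the scaling `μ_ε = ε^{-(d-1)}`, for every `s` and
every compact set `K` of `s`-configurations with pairwise distinct positions (so `K ⊆ D_ε^s`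
for `ε` small), `F^{(s)}_{ε,0} → f₀^{⊗s}` uniformly on `K` as `ε → 0⁺`. Indeed
`F^{(s)}_{ε,0} = f₀^{⊗s} R_ε` with `0 ≤ 1 - R_ε(Z_s) ≤ s 2^d ε ∫ g` on `D_ε^s`: the *ratio*
converges uniformly without any regularity of `f₀`, the *difference* only after multiplying by
a bound of `f₀^{⊗s}` on `K`, whence the boundedness hypothesis `hf₀b : BddAbove (range f₀)`
(without it the statement fails, e.g. `s = 1`, `f₀(x, v) = |v|⁻¹ 1_{|v| ≤ 1}` in `d = 2`;
continuity of `f₀` would do as well). [cite: BGSS2023, §1.1] -/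
def gcInitial_chaotic : Prop :=
  ∀ (hd : 2 ≤ Fintype.card d) {f₀ : UnitAddTorus d × EuclideanSpace ℝ d → ℝ} (hf₀ : 0 ≤ f₀) (hf₀' : Integrable f₀) (hf₀b : BddAbove (range f₀)) {g : EuclideanSpace ℝ d → ℝ} (hg : Integrable g) (hfg : ∀ x v, f₀ (x, v) ≤ g v) (s : ℕ) {K : Set (Literature.Analysis.FluidPDE.Config s d (UnitAddTorus d))} (hK : IsCompact K) (hKoff : K ⊆ {Zs | ∀ i j, i ≠ j → (Zs i).1 ≠ (Zs j).1}),
    TendstoUniformlyOn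
      (fun (ε : ℝ) (Zs : Literature.Analysis.FluidPDE.Config s d (UnitAddTorus d)) =>
        Literature.Analysis.FluidPDE.correlationFn (ε⁻¹ ^ (Fintype.card d - 1))
          (Literature.Analysis.FluidPDE.gcInitial (Literature.Analysis.FluidPDE.Torus.geometry d) ε (ε⁻¹ ^ (Fintype.card d - 1)) f₀) s Zs)
      (Literature.Analysis.FluidPDE.tensorPow s f₀) (𝓝[>] 0) K

end GrandCanonical

/-! ## hilbert6.S07: the BBGKY hierarchy and its Duhamel expansion -/

section BBGKY

/-- **hilbert6.S07** (from the Liouville equation to the BBGKY hierarchy on `T^d`; CIP 1994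
§4.3, (4.3.10); GST 2013 §4.3, (4.3.2)–(4.3.8) (the proposition number of the mild form in
GST §4.3 is left unspecified here and in K3, pending a check of the printed text); Simonella
2014 for the rigorous mild form). Let `0 < ε ≤ 1/2` (so that the contact set
`|x_i - x_j|_{T^d} = ε` on the unit torus is the round minimal-image sphere `x_j = x_i + ε ω`
parametrising the collision operator, as in the prelude), let `Φ s` be the hard-sphere flows
of all orders `s` and let `W` be a symmetric, integrable `N`-particle density on
`(T^d × ℝ^d)^N`,
*continuous on the phase space* `D_ε^N` (boundary `∂D_ε^N` included: this covers the
Gibbs-type data `𝒵_N⁻¹ 1_{D_ε^N} f₀^{⊗N}` of **hilbert6.S06** for continuous `f₀`, which are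
discontinuous across `∂D_ε^N` as functions on `(T^d × ℝ^d)^N`), with a Lanford-class Gaussian
velocity bound `|W| ≤ C e^{-β E_N}` (which makes the collision integrals of the marginals
converge) and vanishing off `D_ε^N`. Then the marginals
`f_N^{(s)}(t, Z_s) = ∫ W(Φ^N_{-t}(Z_s, z_{s+1}, …, z_N)) dz_{s+1} ⋯ dz_N`, `s ≤ N`, `t ∈ [0, T]`,
of the transported density (restricted to the full-measure good set of `Φ N`, off which the
prelude's flow is junk) admit versions `F^{(s)}` (they are only determined a.e.; the collision
operators `C_{s,s+1}` are boundary integrals over incoming configurations, GST (4.3.6)) which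
form a mild solution of the BBGKY hierarchy
`F^{(s)}(t) = T^ε_s(t) F^{(s)}(0) + ∫_0^t T^ε_s(t - τ) C_{s,s+1} F^{(s+1)}(τ) dτ` on `[0, T]`
at every good `s`-configuration (`Kinetic.IsMildBBGKYSolutionOnGood`).

As in the prelude (K3), the conclusion pins `F^{(s)}(t)` only a.e. and the Duhamel identity
only on `(Φ s).good`, so the boundary values of `F^{(s+1)}` entering `C_{s,s+1}` are part of
the existential choice: the statement reads "the marginals solve the hierarchy for *some*
choice of traces". The printed statement pins the trace by the regularity of the marginals
along the flow (GST 2013 Ch. 5, Simonella 2014); that refinement is not stated here. Proof: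
the prelude's `Kinetic.liouville_imp_bbgky` (itself sorried with the citation). [cite: GST2013, Ch. 5  Simonella 2014] -/
def bbgky_hierarchy_of_liouville : Prop :=
  ∀ {ε : ℝ} (hε : 0 < ε) (hε' : ε ≤ 2⁻¹) {N : ℕ} (Φ : (s : ℕ) → Literature.Analysis.FluidPDE.HardSphereFlow (Literature.Analysis.FluidPDE.Torus.geometry d) ε s) {T : ℝ} (hT : 0 ≤ T) {W : Literature.Analysis.FluidPDE.Config N d (UnitAddTorus d) → ℝ} (hW : Literature.Analysis.FluidPDE.IsSymmetricFn W) (hWc : ContinuousOn W (Literature.Analysis.FluidPDE.hardSphereDomain (Literature.Analysis.FluidPDE.Torus.geometry d) N ε)) (hWi : Integrable W) (hWb : ∃ C β : ℝ, 0 < β ∧ ∀ z, |W z| ≤ C * Real.exp (-β * Literature.Analysis.FluidPDE.configEnergy z)) (hWD : ∀ z ∉ Literature.Analysis.FluidPDE.hardSphereDomain (Literature.Analysis.FluidPDE.Torus.geometry d) N ε, W z = 0),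
    ∃ F : (s : ℕ) → ℝ → Literature.Analysis.FluidPDE.Config s d (UnitAddTorus d) → ℝ,
      Literature.Analysis.FluidPDE.IsMildBBGKYSolutionOnGood T (Literature.Analysis.FluidPDE.Torus.geometry d) ε N Φ F ∧
        ∀ s ≤ N, ∀ t ∈ Icc 0 T, F s t =ᵐ[volume]
          Literature.Analysis.FluidPDE.nthMarginal N s ((Φ N).good.indicator (Literature.Analysis.FluidPDE.hsTransport (Φ N) t W))

/- interim proof relied on results that are now named facts (D-0014); demoted to a fact by the M5 import, proof preserved:
:=
  Kinetic.liouville_imp_bbgky hε hε' Φ hT hW hWc hWi hWb hWD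
-/

/-- **hilbert6.S07** (iterated Duhamel / collision-tree expansion of the BBGKY hierarchy on
`T^d`; CIP 1994 (4.4.1); GST 2013 (4.3.9), (4.4.2)–(4.4.4); the re-parametrisation of the
`n`-th term by pseudo-trajectories is GST 2013 Ch. 5, only cited). An (everywhere) mild
solution `F = (F^{(s)})_{s}` of the `N`-particle BBGKY hierarchy on `[0, T]`
(`Kinetic.IsMildBBGKYSolutionOn` — not the `…OnGood` notion produced by
`bbgky_hierarchy_of_liouville`, see the module docstring), jointly measurable and with a
Gaussian velocity bound `|F^{(s)}(t, Z_s)| ≤ C e^{-β E(Z_s)}` for `s ≤ N`, along flows `Φ s`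
normalised to conserve the kinetic energy at every configuration and to be jointly measurable
in `(t, Z_s)` (the prelude's `hΦE`, `hΦm`), is the *finite* sum of its iterated Duhamel terms:
for `s ≤ N` and `t ∈ [0, T]`,
`F^{(s)}(t) = ∑_{n=0}^{N-s} ∫_0^t ∫_0^{t_1} ⋯ ∫_0^{t_{n-1}} T^ε_s(t - t_1) C_{s,s+1}
T^ε_{s+1}(t_1 - t_2) C_{s+1,s+2} ⋯ T^ε_{s+n}(t_n) F^{(s+n)}(0) dt_n ⋯ dt_1`
(`Kinetic.bbgkyDuhamelTerm`; the sum stops at `n = N - s` since `C_{N,N+1} = 0`). Proof: the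
prelude's `Kinetic.IsMildBBGKYSolutionOn.eq_sum_bbgkyDuhamelTerm` with
`Torus.measurable_geometry_translate`. [cite: CIP1994, (4.4.1] -/
def bbgky_duhamel_expansion : Prop :=
  ∀ {ε : ℝ} {N : ℕ} {Φ : (s : ℕ) → Literature.Analysis.FluidPDE.HardSphereFlow (Literature.Analysis.FluidPDE.Torus.geometry d) ε s} {T : ℝ} {F : (s : ℕ) → ℝ → Literature.Analysis.FluidPDE.Config s d (UnitAddTorus d) → ℝ} (hF : Literature.Analysis.FluidPDE.IsMildBBGKYSolutionOn T (Literature.Analysis.FluidPDE.Torus.geometry d) ε N Φ F) (hΦE : ∀ s ≤ N, ∀ (t : ℝ) (z : Literature.Analysis.FluidPDE.Config s d (UnitAddTorus d)), Literature.Analysis.FluidPDE.configEnergy ((Φ s).flow t z) = Literature.Analysis.FluidPDE.configEnergy z) (hΦm : ∀ s ≤ N, Measurable fun p : ℝ × Literature.Analysis.FluidPDE.Config s d (UnitAddTorus d) => (Φ s).flow p.1 p.2) (hmeas : ∀ s ≤ N, Measurable fun p : ℝ × Literature.Analysis.FluidPDE.Config s d (UnitAddTorus d) => F s p.1 p.2)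 (hbound : ∃ C β : ℝ, 0 < β ∧ ∀ s ≤ N, ∀ t ∈ Icc 0 T, ∀ Zs : Literature.Analysis.FluidPDE.Config s d (UnitAddTorus d), |F s t Zs| ≤ C * Real.exp (-β * Literature.Analysis.FluidPDE.configEnergy Zs)) {s : ℕ} (hs : s ≤ N) {t : ℝ} (ht : t ∈ Icc 0 T),
    F s t = ∑ n ∈ Finset.range (N - s + 1),
      Literature.Analysis.FluidPDE.bbgkyDuhamelTerm (Literature.Analysis.FluidPDE.Torus.geometry d) ε N Φ n s t fun k => F k 0

/- interim proof relied on results that are now named facts (D-0014); demoted to a fact by the M5 import, proof preserved: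
:=
  hF.eq_sum_bbgkyDuhamelTerm Torus.measurable_geometry_translate hΦE hΦm hmeas hbound hs ht
-/

/-- **hilbert6.S07** (the Boltzmann hierarchy on `T^d` and its Duhamel series; Lanford 1975;
CIP 1994 §4.4; GST 2013 (4.4.5)–(4.4.7) and Ch. 5). The *Boltzmann hierarchy* is the formal
`ε → 0`, `(N - s) ε^{d-1} → 1` limit of the BBGKY hierarchy: free transport `T_s(t)` in place of
the hard-sphere transport and the collision operator `C⁰_{s,s+1} = Kinetic.boltzmannHOp`
(`Kinetic.bbgkyOp` at `ε = 0`, i.e. the added particle sits at `x_{s+1} = x_i`); a mild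
solution on `[0, T]` (`Kinetic.IsMildBoltzmannHierarchySolutionOn`) satisfies
`F^{(s)}(t) = T_s(t) F^{(s)}(0) + ∫_0^t T_s(t - τ) C⁰_{s,s+1} F^{(s+1)}(τ) dτ` for all `s`. If
`d ≥ 2` and `F` is jointly measurable with Lanford-class bounds
`|F^{(s)}(t, Z_s)| ≤ C b^s e^{-β E(Z_s)}` on `[0, T]`, then for a short time `T' ∈ (0, T]`
(depending on `d, C, b, β`) it is the sum of its iterated Duhamel (collision-tree) series,
`F^{(s)}(t) = ∑_{n ≥ 0} Q⁰_{s,s+n}(t) F(0)` (`Kinetic.boltzmannDuhamelTerm`), `t ∈ [0, T']`.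
Proof: the prelude's
`Kinetic.IsMildBoltzmannHierarchySolutionOn.exists_hasSum_boltzmannDuhamelTerm`. [cite: Lanford1975] -/
def boltzmann_hierarchy_duhamel_series : Prop :=
  ∀ (hd : 2 ≤ Fintype.card d) {T : ℝ} (hT : 0 < T) {F : (s : ℕ) → ℝ → Literature.Analysis.FluidPDE.Config s d (UnitAddTorus d) → ℝ} (hF : Literature.Analysis.FluidPDE.IsMildBoltzmannHierarchySolutionOn T (Literature.Analysis.FluidPDE.Torus.geometry d) F) (hmeas : ∀ s, Measurable fun p : ℝ × Literature.Analysis.FluidPDE.Config s d (UnitAddTorus d) => F s p.1 p.2) (hbound : ∃ C b β : ℝ, 0 < β ∧ ∀ s, ∀ t ∈ Icc 0 T, ∀ Zs : Literature.Analysis.FluidPDE.Config s d (UnitAddTorus d), |F s t Zs| ≤ C * b ^ s * Real.exp (-β * Literature.Analysis.FluidPDE.configEnergy Zs)),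
    ∃ T' ∈ Ioc 0 T, ∀ s, ∀ t ∈ Icc 0 T', ∀ Zs : Literature.Analysis.FluidPDE.Config s d (UnitAddTorus d),
      HasSum (fun n => Literature.Analysis.FluidPDE.boltzmannDuhamelTerm (Literature.Analysis.FluidPDE.Torus.geometry d) n s t (fun k => F k 0) Zs)
        (F s t Zs)

/- interim proof relied on results that are now named facts (D-0014); demoted to a fact by the M5 import, proof preserved:
:=
  hF.exists_hasSum_boltzmannDuhamelTerm hd hT hmeas hbound
-/

end BBGKY

end Hilbert6

end

end Literature.MathematicalPhysics.KineticTheory
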